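/-
# [B4] (2.18) p.578 — the per-cube HÖLDER input `‖P_H·h_jG_k(Ω,Ã_j)h_j‖` on a box, uniformly in `η`

statement-level skeleton of published theorems with citation tags; proofs where landed; nothing here is a claim about
the Yang–Mills mass gap

[B4] = Balaban, *Regularity and decay of lattice Green's functions*, Commun. Math. Phys. 89 (1983) 571–597.

p.578 (2.18): «using (2.3), (2.4) and Lemma 2.2 we get ‖h_{ω₀}G_k(□_{ω₀},Ã_{ω₀})h_{ω₀}…f‖_{1,α} ≤ c₁‖…‖_∞» — the first
letter of every walk carries the norm `‖·‖_{1,α}` of (2.14), whose third member is the Hölder quotient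
`|x−x′|^{−α}|U(A(Γ_{x,x′}))(D^η_{A,μ}f)(x′) − (D^η_{A,μ}f)(x)|`.  In the owner's operator form (`B4Ineq19WalkRoute` §2) this is
the probe `P_H = σ·(E_{xy′}[UW′] − E_{xx′}[U] − (E_{xy}[W] − E_{xx}[1]))` with, at the fine-lattice scale `η = n^{-1}`,
`σ = n·(n/r)^α`, `r = |x′ − x|_∞` (fine units), `U = U(Ã(Γ))` the transport along a nearest-neighbour chain `Γ` from
`x` to `x′`, `y = x + e_μ`, `y′ = x′ + e_μ`.

THIS FILE proves, for ONE cube configuration `B` (antisymmetric) on the box `Ω = Box d ℓ k Mb`, an operator `G` (its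
Green's function) and the concrete `h_j = hBox n K Mb j`, the bound
`‖P_H·(h_jGh_j)‖ ≤ √N·(c_H + (d+1)D1·c_D + (d+3)s·c_D + (d+1)(D1² + D2)·c_G)` (`holder_letter_box`) from the lineage's
`supN` inputs on `G`: the value bound `c_G`, the derivative bounds `c_D` (all directions) and the Hölder bound `c_H` (p35's
form `(n/r)^α|U(B(Γ))(D^η_{B,μ}GΦ)(x′) − (D^η_{B,μ}GΦ)(x)| ≤ c_H‖Φ‖_∞`), via the paired Leibniz split
`B4HolderProbeLeibniz.norm_holderOp_letter_pair` and the sizes of `h_j`: `|h_j(x′) − h_j(x)| ≤ D1(d+1)r/(nK)`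
(`abs_hCube_sub_le`), `n|h_j(x′+e_μ) − h_j(x′)| ≤ s/K` (`hsize_hBox`), the mixed second difference `≤ (D1²+D2)(d+1)r/(n²K²)`
(`B4HCubeMixedDiff.mixedDiff_hZ_le`), and the transported value difference along the chain `y, x, Γ, y′`
(`chain_covariation_le`, `(|Γ|+2)·c_D/n`).  Every product `σ × (size) × (input)` reduces to `(r/n)^{1−α} ≤ K` times a
constant: the bound is UNIFORM IN `η` (and in `r ≤ nK`).

HONEST SCOPE.  One configuration `B` on a box and abstract inputs; the identification `B = Ã_j`, `A = Ã_j` on the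
relevant bonds and the walk route are the sequel (`B4Thm19BoxHolderWalk`).  No `def`, no `Prop` fact, no `sorry`; axioms
standard.
-/
import Literature.MathematicalPhysics.QuantumFieldTheory.Balaban1983to89.B4HolderChainTools

namespace Literature.MathematicalPhysics.QuantumFieldTheory.Balaban1983to89.B4HolderLetterBox

open Literature.MathematicalPhysics.QuantumFieldTheory.Balaban1983to89.B4Reflection242 (boxDom nbrs mem_nbrs)
open Literature.MathematicalPhysics.QuantumFieldTheory.Balaban1983to89.B4GaugeCovariance
open Literature.MathematicalPhysics.QuantumFieldTheory.Balaban1983to89.B4Commutators25to211 (mulH fld_mulH_mulVec)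
open Literature.MathematicalPhysics.QuantumFieldTheory.Balaban1983to89.B4Lower18Regular (e1 lsum transport_fieldLink
  pathEnd_append)
open Literature.MathematicalPhysics.QuantumFieldTheory.Balaban1983to89.B4Lemma21Region (siteNorm covDeriv
  fld_covDeriv_mulVec_of_mem)
open Literature.MathematicalPhysics.QuantumFieldTheory.Balaban1983to89.B4Lemma22ReduceZero (Box derivA
  siteNorm_gauge_mulVec)
open Literature.MathematicalPhysics.QuantumFieldTheory.Balaban1983to89.B4Lemma22Reduce231 (supN supN_nonneg le_supN
  supN_le siteNorm_nonneg siteNorm_zero siteNorm_smul siteNorm_add_le)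
open Literature.MathematicalPhysics.QuantumFieldTheory.Balaban1983to89.B4PartitionUnity22 (hCube hCube_nonneg
  hCube_le_one hprof D1 D2 D1_nonneg D2_nonneg contDiff_hprof hasCompactSupport_hprof)
open Literature.MathematicalPhysics.QuantumFieldTheory.Balaban1983to89.B4ContourShift (supNorm abs_le_supNorm
  supNorm_nonneg)
open Literature.MathematicalPhysics.QuantumFieldTheory.Balaban1983to89.B4Green242Bridge (boxNbrs)
open Literature.MathematicalPhysics.QuantumFieldTheory.Balaban1983to89.B4Eq220CommutatorZeroBox (HSize mem_boxNbrs_iff)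
open Literature.MathematicalPhysics.QuantumFieldTheory.Balaban1983to89.B4Eq220PartitionSizes (hZ hBox hsize_hBox
  abs_hCube_sub_le)
open Literature.MathematicalPhysics.QuantumFieldTheory.Balaban1983to89.B4Lemma22HolderBox (IsNNChain)
open Literature.MathematicalPhysics.QuantumFieldTheory.Balaban1983to89.B4Lemma22ReduceDeriv (siteNorm_flow)
open Literature.MathematicalPhysics.QuantumFieldTheory.Balaban1983to89.B4Ineq110WalkRoute (norm_mulH_le)
open Literature.MathematicalPhysics.QuantumFieldTheory.Balaban1983to89.B4Ineq110WalkRouteDeriv (unitOp_apply)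
open Literature.MathematicalPhysics.QuantumFieldTheory.Balaban1983to89.B4Ineq19WalkRoute (fld_unitOp_mulVec
  fld_holderOp_mulVec)
open Literature.MathematicalPhysics.QuantumFieldTheory.Balaban1983to89.B4CubeOpReindex (linfty_opNorm_le_of_supN)
open Literature.MathematicalPhysics.QuantumFieldTheory.Balaban1983to89.B4HCubeMixedDiff (mixedDiff_hZ_le)
open Literature.MathematicalPhysics.QuantumFieldTheory.Balaban1983to89.B4HolderProbeLeibniz (norm_holderOp_letter_pair)
open Literature.MathematicalPhysics.QuantumFieldTheory.Balaban1983to89.B4HolderChainTools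
open scoped Matrix
open scoped Matrix.Norms.Operator

noncomputable section

variable {d : ℕ}
variable {ι : Type} [Fintype ι] [DecidableEq ι]

/-! ## 3a. Three algebraic identities of the bookkeeping; `fld` linearity -/

omit [DecidableEq ι] in
/-- `fld` is linear: differences. [folklore] -/
private theorem fld_sub_mulVec {X : Type} [Fintype X] (A B : Matrix (X × ι) (X × ι) ℝ) (Φ : X × ι → ℝ) (z : X) :
    fld ((A - B) *ᵥ Φ) z = fld (A *ᵥ Φ) z - fld (B *ᵥ Φ) z := by
  rw [Matrix.sub_mulVec]; rfl

omit [DecidableEq ι] in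
/-- `fld` is linear: scalars. [folklore] -/
private theorem fld_smul_mulVec {X : Type} [Fintype X] (σ : ℝ) (A : Matrix (X × ι) (X × ι) ℝ) (Φ : X × ι → ℝ)
    (z : X) : fld ((σ • A) *ᵥ Φ) z = σ • fld (A *ᵥ Φ) z := by
  rw [Matrix.smul_mulVec]; rfl


/-- bookkeeping identity for the product `θ_a·γ_T`. [folklore] -/
private theorem alg1 {w r nr K D1' dd cD S : ℝ} (hnr : nr ≠ 0) (hK : K ≠ 0) :
    w * (D1' * (dd * r) / K) * (S * (cD / nr)) = w * r / nr / K * (dd * D1' * cD * S) := by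
  field_simp

/-- bookkeeping identity for the product `θ_b·γ_Δ`. [folklore] -/
private theorem alg2 {w r nr K s₁ d3 cD S : ℝ} (hnr : nr ≠ 0) (hK : K ≠ 0) :
    w * (s₁ / K) * (S * ((d3 * r) * (cD / nr))) = w * r / nr / K * (d3 * s₁ * cD * S) := by
  field_simp

/-- bookkeeping identity for the product `θ_m·γ_V`. [folklore] -/
private theorem alg3 {w r nr K D12 dd cG S : ℝ} (hnr : nr ≠ 0) (hK : K ≠ 0) :
    w * (D12 * (dd * r) / (nr * K ^ 2)) * (S * cG) = w * r / nr / K * ((dd * D12 * cG * S) / K) := by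
  field_simp

/-! ## 3. The per-cube Hölder letter on the box -/

/-- **THE PER-CUBE HÖLDER INPUT OF (2.18), UNIFORM IN `η`**: for a cube configuration `B` (antisymmetric) on the box, an
operator `G` with the lineage's bounds `‖GΦ‖_∞ ≤ c_G‖Φ‖_∞`, `‖D^η_{B,ν}GΦ‖_∞ ≤ c_D‖Φ‖_∞` (all `ν`) and the Hölder bound
`(n/r)^α|U(B(Γ))(D^η_{B,μ}GΦ)(x′) − (D^η_{B,μ}GΦ)(x)| ≤ c_H‖Φ‖_∞` along a nearest-neighbour chain `Γ` from `x` to `x′ ≠ x`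
(`|Γ| ≤ (d+1)r`, `r = |x′−x|_∞ ≤ nK`), and the concrete `h_j` of the box (sides multiples of `K`, `nK ≥ 3`):
`‖P_H·(h_jGh_j)‖ ≤ √N·(c_H + (d+1)D1·c_D + (d+3)s·c_D + (d+1)(D1²+D2)·c_G)`, `s = (d+1)(D1+D2)`, where
`P_H = n(n/r)^α·(E_{xy′}[U(B(Γ))U(B_{x′y′})] − E_{xx′}[U(B(Γ))] − (E_{xy}[U(B_{xy})] − E_{xx}[1]))`, `y = x+e_μ`, `y′ = x′+e_μ`.
[cite: Balaban1983RegularityDecay, (2.18) p.578 with (2.3)–(2.4) p.575, (2.14) p.577, p.577 «|∂^ηh_j| ≤ O(M⁻¹)»] -/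
theorem holder_letter_box (F : OrthFlow ι) (κ : ℝ) {ℓ k : ℕ} (hn : 1 ≤ (ℓ + 1) ^ k) {Mb : Fin (d + 1) → ℕ}
    {K : ℕ} (hK : 1 ≤ K) (hnK : 3 ≤ (ℓ + 1) ^ k * K) (hKM : ∀ ν, K ∣ Mb ν)
    (B : ↥(Box d ℓ k Mb) → ↥(Box d ℓ k Mb) → ℝ) (hB : ∀ u v, B v u = -B u v)
    (Gi : Matrix (↥(Box d ℓ k Mb) × ι) (↥(Box d ℓ k Mb) × ι) ℝ) (i : Fin (d + 1) → ℤ)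
    {cG cD cH : ℝ} (hcG : 0 ≤ cG) (hcD : 0 ≤ cD) (hcH : 0 ≤ cH)
    (hG : ∀ Φ : ↥(Box d ℓ k Mb) × ι → ℝ, supN (Gi *ᵥ Φ) ≤ cG * supN Φ)
    (hDG : ∀ (ν : Fin (d + 1)) (Φ : ↥(Box d ℓ k Mb) × ι → ℝ),
      supN (derivA d F κ ℓ k Mb B ν *ᵥ (Gi *ᵥ Φ)) ≤ cD * supN Φ)
    (μ : Fin (d + 1)) (x x' : ↥(Box d ℓ k Mb)) (hxμ : x.1 + e1 μ ∈ Box d ℓ k Mb)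
    (hx'μ : x'.1 + e1 μ ∈ Box d ℓ k Mb) (hne : x'.1 ≠ x.1)
    (hrK : supNorm (x'.1 - x.1) ≤ (((ℓ + 1) ^ k : ℕ) : ℝ) * K)
    (l : List ↥(Box d ℓ k Mb)) (hl : IsNNChain x l) (hlend : pathEnd x l = x')
    (hlen : (l.length : ℝ) ≤ ((d : ℝ) + 1) * supNorm (x'.1 - x.1)) {α : ℝ} (hα0 : 0 ≤ α) (hα1 : α ≤ 1)
    (hH : ∀ Φ : ↥(Box d ℓ k Mb) × ι → ℝ,
      ((((ℓ + 1) ^ k : ℕ) : ℝ) / supNorm (x'.1 - x.1)) ^ α *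
        siteNorm (transport (fieldLink F κ B) x l *ᵥ fld (derivA d F κ ℓ k Mb B μ *ᵥ (Gi *ᵥ Φ)) x'
          - fld (derivA d F κ ℓ k Mb B μ *ᵥ (Gi *ᵥ Φ)) x) ≤ cH * supN Φ) :
    ‖((((ℓ + 1) ^ k : ℕ) : ℝ) * ((((ℓ + 1) ^ k : ℕ) : ℝ) / supNorm (x'.1 - x.1)) ^ α) •
        (unitOp x ⟨x'.1 + e1 μ, hx'μ⟩ (transport (fieldLink F κ B) x l * fieldLink F κ B x' ⟨x'.1 + e1 μ, hx'μ⟩)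
          - unitOp x x' (transport (fieldLink F κ B) x l)
          - (unitOp x ⟨x.1 + e1 μ, hxμ⟩ (fieldLink F κ B x ⟨x.1 + e1 μ, hxμ⟩) - unitOp x x 1))
      * (mulH (ι := ι) (hBox ((ℓ + 1) ^ k) K Mb i) * Gi * mulH (ι := ι) (hBox ((ℓ + 1) ^ k) K Mb i))‖
      ≤ Real.sqrt (Fintype.card ι) * (cH + ((d : ℝ) + 1) * D1 hprof * cD
          + ((d : ℝ) + 3) * (((d : ℝ) + 1) * (D1 hprof + D2 hprof)) * cD
          + ((d : ℝ) + 1) * (D1 hprof ^ 2 + D2 hprof) * cG) := by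
  -- scalars
  have hnr : (0 : ℝ) < (((ℓ + 1) ^ k : ℕ) : ℝ) := by exact_mod_cast hn
  have hKr : (1 : ℝ) ≤ K := by exact_mod_cast hK
  have hK0 : (0 : ℝ) < K := by linarith
  set nr : ℝ := (((ℓ + 1) ^ k : ℕ) : ℝ) with hnr_def
  set r : ℝ := supNorm (x'.1 - x.1) with hr_def
  have hr1 : 1 ≤ r := one_le_supNorm_of_ne hne
  have hr0 : 0 < r := by linarith
  set w : ℝ := (nr / r) ^ α with hw_def
  have hw0 : 0 ≤ w := Real.rpow_nonneg (div_nonneg hnr.le hr0.le) α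
  have hwK : w * (r / nr) ≤ K := holderWt_mul_le hnr hr0 hrK hKr hα0 hα1
  have hD1 := D1_nonneg contDiff_hprof hasCompactSupport_hprof
  have hD2 := D2_nonneg contDiff_hprof hasCompactSupport_hprof
  have hsq : 0 ≤ Real.sqrt (Fintype.card ι) := Real.sqrt_nonneg _
  have hsum : ∑ ν, |((x'.1 ν : ℤ) : ℝ) - x.1 ν| ≤ ((d : ℝ) + 1) * r := sum_abs_sub_le_supNorm x.1 x'.1
  -- the bond and chain data
  set y : ↥(Box d ℓ k Mb) := ⟨x.1 + e1 μ, hxμ⟩ with hy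
  set y' : ↥(Box d ℓ k Mb) := ⟨x'.1 + e1 μ, hx'μ⟩ with hy'
  set W : ↥(Box d ℓ k Mb) → ↥(Box d ℓ k Mb) → Matrix ι ι ℝ := fieldLink F κ B with hW
  set U : Matrix ι ι ℝ := transport W x l with hU
  set h : ↥(Box d ℓ k Mb) → ℝ := hBox ((ℓ + 1) ^ k) K Mb i with hh_def
  have hh_abs : ∀ z, |h z| ≤ 1 := fun z => by
    rw [hh_def, show hBox ((ℓ + 1) ^ k) K Mb i z = hCube (K : ℝ) i _ from rfl, abs_of_nonneg (hCube_nonneg _ _ _)]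
    exact hCube_le_one _ _ _
  have hsz := hsize_hBox hn hK hnK hKM i
  -- the covariant derivative at a forward bond
  have hderiv : ∀ (ν : Fin (d + 1)) (u : ↥(Box d ℓ k Mb)) (hue : u.1 + e1 ν ∈ Box d ℓ k Mb)
      (Ψ : ↥(Box d ℓ k Mb) × ι → ℝ),
      W u ⟨u.1 + e1 ν, hue⟩ *ᵥ fld Ψ ⟨u.1 + e1 ν, hue⟩ - fld Ψ u
        = nr⁻¹ • fld (derivA d F κ ℓ k Mb B ν *ᵥ Ψ) u := by
    intro ν u hue Ψ
    rw [show derivA d F κ ℓ k Mb B ν = covDeriv ((ℓ + 1) ^ k) (Box d ℓ k Mb) (fieldLink F κ B) ν from rfl,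
      fld_covDeriv_mulVec_of_mem ((ℓ + 1) ^ k) (fieldLink F κ B) Ψ hue, smul_smul, inv_mul_cancel₀ hnr.ne',
      one_smul]
  have hbond : ∀ (ν : Fin (d + 1)) (u ue : ↥(Box d ℓ k Mb)), ue.1 = u.1 + e1 ν →
      ∀ Φ : ↥(Box d ℓ k Mb) × ι → ℝ,
      siteNorm (W u ue *ᵥ fld (Gi *ᵥ (mulH (ι := ι) h *ᵥ Φ)) ue - fld (Gi *ᵥ (mulH (ι := ι) h *ᵥ Φ)) u)
        ≤ cD / nr * supN Φ := by
    intro ν u ue hue Φ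
    have hue' : u.1 + e1 ν ∈ Box d ℓ k Mb := by rw [← hue]; exact ue.2
    have heq : ue = ⟨u.1 + e1 ν, hue'⟩ := Subtype.ext hue
    subst heq
    rw [hderiv ν u hue', siteNorm_smul, abs_of_pos (inv_pos.2 hnr), div_eq_inv_mul, mul_assoc]
    exact mul_le_mul_of_nonneg_left ((le_supN _ u).trans ((hDG ν _).trans
      (mul_le_mul_of_nonneg_left (supN_mulH_le h hh_abs Φ) hcD))) (inv_pos.2 hnr).le
  -- (γ_H′) the probe on `G` itself: the Hölder input
  have hγH' : ‖(nr * w) • (unitOp x y' (U * W x' y') - unitOp x x' U - (unitOp x y (W x y) - unitOp x x 1)) * Gi‖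
      ≤ Real.sqrt (Fintype.card ι) * cH := by
    refine rowBlock_opNorm_le _ x hcH (fun Φ => ?_) (fun Φ z hz => ?_)
    · rw [← Matrix.mulVec_mulVec, fld_holderOp_mulVec]
      have e2 : (nr * w) • (U *ᵥ (W x' y' *ᵥ fld (Gi *ᵥ Φ) y' - fld (Gi *ᵥ Φ) x')
          - (W x y *ᵥ fld (Gi *ᵥ Φ) y - fld (Gi *ᵥ Φ) x))
          = w • (U *ᵥ fld (derivA d F κ ℓ k Mb B μ *ᵥ (Gi *ᵥ Φ)) x'
              - fld (derivA d F κ ℓ k Mb B μ *ᵥ (Gi *ᵥ Φ)) x) := by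
        rw [hy, hy', hderiv μ x' hx'μ, hderiv μ x hxμ, Matrix.mulVec_smul, ← smul_sub, smul_smul,
          show nr * w * nr⁻¹ = w by field_simp]
      rw [e2, siteNorm_smul, abs_of_nonneg hw0]
      exact hH Φ
    · rw [← Matrix.mulVec_mulVec, fld_smul_mulVec, fld_sub_mulVec, fld_sub_mulVec, fld_sub_mulVec,
        fld_unitOp_mulVec_ne _ _ _ _ hz, fld_unitOp_mulVec_ne _ _ _ _ hz, fld_unitOp_mulVec_ne _ _ _ _ hz,
        fld_unitOp_mulVec_ne _ _ _ _ hz]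
      simp
  -- (γ_T) the transported bond difference at `b′`
  have hγT : ‖(unitOp x y' (U * W x' y') - unitOp x x' U) * Gi‖ ≤ Real.sqrt (Fintype.card ι) * (cD / nr) := by
    refine rowBlock_opNorm_le _ x (div_nonneg hcD hnr.le) (fun Φ => ?_) (fun Φ z hz => ?_)
    · rw [← Matrix.mulVec_mulVec, fld_sub_mulVec, fld_unitOp_mulVec, fld_unitOp_mulVec, ← Matrix.mulVec_mulVec,
        ← Matrix.mulVec_sub, hy', hderiv μ x' hx'μ, hU, hW, siteNorm_transport_mulVec, siteNorm_smul,
        abs_of_pos (inv_pos.2 hnr), div_eq_inv_mul, mul_assoc]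
      exact mul_le_mul_of_nonneg_left ((le_supN _ x').trans (hDG μ Φ)) (inv_pos.2 hnr).le
    · rw [← Matrix.mulVec_mulVec, fld_sub_mulVec, fld_unitOp_mulVec_ne _ _ _ _ hz,
        fld_unitOp_mulVec_ne _ _ _ _ hz, sub_zero]
  -- (γ_Δ) the transported value difference of `Ghφ` between `y` and `y′`, along the chain `y, x, Γ, y′`
  have hγΔ : ‖(unitOp x y' (U * W x' y') - unitOp x y (W x y)) * Gi * mulH (ι := ι) h‖
      ≤ Real.sqrt (Fintype.card ι) * ((((d : ℝ) + 1) * r + 2) * (cD / nr)) := by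
    have hc0 : 0 ≤ (((d : ℝ) + 1) * r + 2) * (cD / nr) := by positivity
    refine rowBlock_opNorm_le _ x hc0 (fun Φ => ?_) (fun Φ z hz => ?_)
    · set Ψ := Gi *ᵥ (mulH (ι := ι) h *ᵥ Φ) with hΨ
      rw [Matrix.mul_assoc, ← Matrix.mulVec_mulVec, ← Matrix.mulVec_mulVec, ← hΨ, fld_sub_mulVec,
        fld_unitOp_mulVec, fld_unitOp_mulVec]
      -- the chain `y → x → Γ → y′`
      have hxy : x.1 ∈ nbrs y.1 := mem_nbrs.2 ⟨μ, Or.inr (by rw [hy]; simp [e1])⟩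
      have hch : IsNNChain y (x :: (l ++ [y'])) := by
        refine ⟨hxy, isNNChain_append x l [y'] hl ?_⟩
        rw [hlend]
        exact ⟨mem_nbrs.2 ⟨μ, Or.inl rfl⟩, trivial⟩
      have hend : pathEnd y (x :: (l ++ [y'])) = y' := by
        show pathEnd x (l ++ [y']) = y'
        rw [pathEnd_append, hlend]; rfl
      have htr : transport W y (x :: (l ++ [y'])) = W y x * (U * W x' y') := by
        show W y x * transport W x (l ++ [y']) = _
        rw [transport_append, hlend, hU]
        simp [transport]
      have hlenc : (((x :: (l ++ [y'])).length : ℕ) : ℝ) = l.length + 2 := by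
        simp only [List.length_cons, List.length_append, List.length_nil]; push_cast; ring
      have key := chain_covariation_le F κ hB Ψ (fun ν u ue hue => hbond ν u ue hue Φ) y _ hch
      rw [hend, htr, hlenc] at key
      -- `UW′ψ(y′) − Wψ(y) = W(x,y)·(W(y,x)UW′ψ(y′) − ψ(y))`
      have hid : (U * W x' y') *ᵥ fld Ψ y' - W x y *ᵥ fld Ψ y
          = W x y *ᵥ ((W y x * (U * W x' y')) *ᵥ fld Ψ y' - fld Ψ y) := by
        rw [Matrix.mulVec_sub, Matrix.mulVec_mulVec, ← Matrix.mul_assoc, hW, fieldLink_mul_rev F κ hB x y,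
          Matrix.one_mul]
      rw [hid, hW, show fieldLink F κ B x y = F.U (κ * B x y) from rfl, siteNorm_flow]
      refine key.trans ?_
      have hl2 : (l.length : ℝ) + 2 ≤ ((d : ℝ) + 1) * r + 2 := by linarith
      calc ((l.length : ℝ) + 2) * (cD / nr * supN Φ) = ((l.length : ℝ) + 2) * (cD / nr) * supN Φ := by ring
        _ ≤ (((d : ℝ) + 1) * r + 2) * (cD / nr) * supN Φ :=
          mul_le_mul_of_nonneg_right (mul_le_mul_of_nonneg_right hl2 (div_nonneg hcD hnr.le)) (supN_nonneg Φ)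
    · rw [Matrix.mul_assoc, ← Matrix.mulVec_mulVec, fld_sub_mulVec, fld_unitOp_mulVec_ne _ _ _ _ hz,
        fld_unitOp_mulVec_ne _ _ _ _ hz, sub_zero]
  -- (γ_V) the evaluation
  have hγV : ‖unitOp x y (W x y) * Gi‖ ≤ Real.sqrt (Fintype.card ι) * cG := by
    refine rowBlock_opNorm_le _ x hcG (fun Φ => ?_) (fun Φ z hz => ?_)
    · rw [← Matrix.mulVec_mulVec, fld_unitOp_mulVec, hW, show fieldLink F κ B x y = F.U (κ * B x y) from rfl,
        siteNorm_flow]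
      exact (le_supN _ y).trans (hG Φ)
    · rw [← Matrix.mulVec_mulVec, fld_unitOp_mulVec_ne _ _ _ _ hz]
  -- (θ_a) `σ|h(x′) − h(x)| ≤ w·D1(d+1)r/K`
  have hθa : |nr * w * (h x' - h x)| ≤ w * (D1 hprof * (((d : ℝ) + 1) * r) / K) := by
    have h1 : |h x' - h x| ≤ D1 hprof / K * (((d : ℝ) + 1) * r / nr) := by
      have h0 := abs_hCube_sub_le (show (0 : ℝ) < K from hK0) i (fun ν => ((x'.1 ν : ℤ) : ℝ) / nr)
        (fun ν => ((x.1 ν : ℤ) : ℝ) / nr)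
      have hs' : ∑ ν, |((x'.1 ν : ℤ) : ℝ) / nr - ((x.1 ν : ℤ) : ℝ) / nr| ≤ ((d : ℝ) + 1) * r / nr := by
        rw [show ∑ ν, |((x'.1 ν : ℤ) : ℝ) / nr - ((x.1 ν : ℤ) : ℝ) / nr| = (∑ ν, |((x'.1 ν : ℤ) : ℝ) - x.1 ν|) / nr by
          rw [Finset.sum_div]
          exact Finset.sum_congr rfl fun ν _ => by rw [← sub_div, abs_div, abs_of_pos hnr]]
        exact div_le_div_of_nonneg_right hsum hnr.le
      exact h0.trans (mul_le_mul_of_nonneg_left hs' (div_nonneg hD1 hK0.le))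
    rw [abs_mul, abs_of_nonneg (mul_nonneg hnr.le hw0)]
    calc nr * w * |h x' - h x| ≤ nr * w * (D1 hprof / K * (((d : ℝ) + 1) * r / nr)) :=
          mul_le_mul_of_nonneg_left h1 (mul_nonneg hnr.le hw0)
      _ = w * (D1 hprof * (((d : ℝ) + 1) * r) / K) := by field_simp
  -- (θ_b) `σ|h(y′) − h(x′)| ≤ w·s/K`
  have hθb : |nr * w * (h y' - h x')| ≤ w * (((d : ℝ) + 1) * (D1 hprof + D2 hprof) / K) := by
    have h1 : nr * |h y' - h x'| ≤ ((d : ℝ) + 1) * (D1 hprof + D2 hprof) / K :=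
      hsz.grad_le x' y' (mem_boxNbrs_iff.2 (mem_nbrs.2 ⟨μ, Or.inl rfl⟩))
    rw [abs_mul, abs_of_nonneg (mul_nonneg hnr.le hw0)]
    calc nr * w * |h y' - h x'| = w * (nr * |h y' - h x'|) := by ring
      _ ≤ w * (((d : ℝ) + 1) * (D1 hprof + D2 hprof) / K) := mul_le_mul_of_nonneg_left h1 hw0
  -- (θ_m) the mixed second difference `σ|h(y′) − h(x′) − (h(y) − h(x))| ≤ w·(D1²+D2)(d+1)r/(nK²)`
  have hθm : |nr * w * (h y' - h x' - (h y - h x))|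
      ≤ w * ((D1 hprof ^ 2 + D2 hprof) * (((d : ℝ) + 1) * r) / (nr * (K : ℝ) ^ 2)) := by
    have h1 : |h y' - h x' - (h y - h x)| ≤ (D1 hprof ^ 2 + D2 hprof) * (((d : ℝ) + 1) * r) / (nr ^ 2 * (K : ℝ) ^ 2) := by
      have h0 := mixedDiff_hZ_le hn hK i x.1 x'.1 μ
      have heq : h y' - h x' - (h y - h x)
          = hZ ((ℓ + 1) ^ k) K i (x'.1 + Pi.single μ 1) - hZ ((ℓ + 1) ^ k) K i x'.1
            - hZ ((ℓ + 1) ^ k) K i (x.1 + Pi.single μ 1) + hZ ((ℓ + 1) ^ k) K i x.1 := by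
        show hZ _ K i y'.1 - hZ _ K i x'.1 - (hZ _ K i y.1 - hZ _ K i x.1) = _
        rw [hy, hy']; simp only [e1]; ring
      rw [heq]
      refine h0.trans ?_
      rw [hnr_def]
      exact div_le_div_of_nonneg_right (mul_le_mul_of_nonneg_left hsum (by positivity)) (by positivity)
    rw [abs_mul, abs_of_nonneg (mul_nonneg hnr.le hw0)]
    calc nr * w * |h y' - h x' - (h y - h x)|
        ≤ nr * w * ((D1 hprof ^ 2 + D2 hprof) * (((d : ℝ) + 1) * r) / (nr ^ 2 * (K : ℝ) ^ 2)) :=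
          mul_le_mul_of_nonneg_left h1 (mul_nonneg hnr.le hw0)
      _ = w * ((D1 hprof ^ 2 + D2 hprof) * (((d : ℝ) + 1) * r) / (nr * (K : ℝ) ^ 2)) := by field_simp
  -- the paired Leibniz bound
  have main := norm_holderOp_letter_pair x y x' y' U W (nr * w) h hh_abs Gi
    (by positivity) (by positivity) hγH' hγT hγΔ hγV hθa hθb hθm
  refine main.trans ?_
  -- bookkeeping: every product is `(w·r/n)/K × const ≤ const`
  have hq : w * r / nr / K ≤ 1 := by rw [div_le_one hK0, mul_div_assoc]; exact hwK
  have hq0 : 0 ≤ w * r / nr / K := by positivity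
  set S := Real.sqrt (Fintype.card ι) with hS
  set s₁ := ((d : ℝ) + 1) * (D1 hprof + D2 hprof) with hs₁
  have hs₁0 : 0 ≤ s₁ := by rw [hs₁]; positivity
  -- the three products
  have p1 : w * (D1 hprof * (((d : ℝ) + 1) * r) / K) * (S * (cD / nr))
      = w * r / nr / K * (((d : ℝ) + 1) * D1 hprof * cD * S) :=
    alg1 hnr.ne' hK0.ne'
  have p2 : w * (s₁ / K) * (S * ((((d : ℝ) + 1) * r + 2) * (cD / nr)))
      ≤ w * r / nr / K * (((d : ℝ) + 3) * s₁ * cD * S) := by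
    have h2r : ((d : ℝ) + 1) * r + 2 ≤ ((d : ℝ) + 3) * r := by
      have : ((d : ℝ) + 3) * r = ((d : ℝ) + 1) * r + 2 * r := by ring
      rw [this]; linarith
    have step : w * (s₁ / K) * (S * ((((d : ℝ) + 1) * r + 2) * (cD / nr)))
        ≤ w * (s₁ / K) * (S * ((((d : ℝ) + 3) * r) * (cD / nr))) := by
      have : 0 ≤ w * (s₁ / K) := by positivity
      refine mul_le_mul_of_nonneg_left (mul_le_mul_of_nonneg_left
        (mul_le_mul_of_nonneg_right h2r (div_nonneg hcD hnr.le)) hsq) this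
    refine step.trans (le_of_eq ?_)
    exact alg2 hnr.ne' hK0.ne'
  have p3 : w * ((D1 hprof ^ 2 + D2 hprof) * (((d : ℝ) + 1) * r) / (nr * (K : ℝ) ^ 2)) * (S * cG)
      = w * r / nr / K * ((((d : ℝ) + 1) * (D1 hprof ^ 2 + D2 hprof) * cG * S) / K) :=
    alg3 hnr.ne' hK0.ne'
  -- `q/K·C ≤ C`
  have c1 : 0 ≤ ((d : ℝ) + 1) * D1 hprof * cD * S := by positivity
  have c2 : 0 ≤ ((d : ℝ) + 3) * s₁ * cD * S := by positivity
  have c3 : 0 ≤ ((d : ℝ) + 1) * (D1 hprof ^ 2 + D2 hprof) * cG * S := by positivity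
  have bq : ∀ C : ℝ, 0 ≤ C → w * r / nr / K * C ≤ C := fun C hC =>
    (mul_le_mul_of_nonneg_right hq hC).trans_eq (one_mul C)
  have b1 := bq _ c1
  have b2 := bq _ c2
  have b3 : w * r / nr / K * ((((d : ℝ) + 1) * (D1 hprof ^ 2 + D2 hprof) * cG * S) / K)
      ≤ ((d : ℝ) + 1) * (D1 hprof ^ 2 + D2 hprof) * cG * S :=
    (bq _ (div_nonneg c3 hK0.le)).trans (div_le_self c3 hKr)
  rw [p1, p3]
  have htot : S * cH + ((d : ℝ) + 1) * D1 hprof * cD * S + ((d : ℝ) + 3) * s₁ * cD * S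
      + ((d : ℝ) + 1) * (D1 hprof ^ 2 + D2 hprof) * cG * S
      = S * (cH + ((d : ℝ) + 1) * D1 hprof * cD + ((d : ℝ) + 3) * s₁ * cD
          + ((d : ℝ) + 1) * (D1 hprof ^ 2 + D2 hprof) * cG) := by ring
  rw [← htot]
  linarith [p2, b1, b2, b3]

end

end Literature.MathematicalPhysics.QuantumFieldTheory.Balaban1983to89.B4HolderLetterBox
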